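import Summits.CriticalPhenomena.PercolationContinuityZ3.Theorems.PercFiniteBoxLROLinearScaleLROOfThetaShellTools
import HarnessLib

/-!
# `PercFiniteBoxLRO.LinearScaleLROOfTheta` (stmt-CriticalPhenomena-0855): shell tools at an
# arbitrary aspect ratio (bond percolation on `ℤ³`)

Helper file (`--supports stmt-CriticalPhenomena-0855`) of line `registered` (lead c1).  The shell
tools of `PercFiniteBoxLROLinearScaleLROOfThetaShellTools.lean` (aspect ratio `2`) for a general
shell `Λ_{q+1} ∖ Λ_k`, `k < q`, with inner sphere `∂ⁱⁿΛ_{k+1}` and outer sphere `∂ⁱⁿΛ_{q+1}`: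

* `ShellUniq.shell_segment_gen` — an open path inside `Λ_R` from `u ∈ Λ_k` to a site outside `Λ_q`
  contains an open crossing of `Λ_{q+1} ∖ Λ_k` from `∂ⁱⁿΛ_{k+1}` to `∂ⁱⁿΛ_{q+1}` whose inner end is
  joined to `u` inside `Λ_R`;
* `ShellUniq.shell_split_gen`, `shellSplitGen_of_percolating_pair` (registered sub-goal) — two
  percolating sites of `Λ_k` not joined inside `Λ_R ⊇ Λ_{q+1}` give two crossings of
  `Λ_{q+1} ∖ Λ_k` not joined inside it;
* `ShellUniq.determinedBy_shellUniq_gen` — the shell-uniqueness event of `Λ_{q+1} ∖ Λ_k` is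
  determined by the pairs of sites of that shell.

They feed `PercFiniteBoxLROLinearScaleLROOfThetaShellUniqAspect.lean`: positive-probability
uniqueness of the crossings of shells of SOME fixed aspect ratio at `p_c` ⟹ the crux `X_D`.

## References

* G. Grimmett, *Percolation*, 2nd ed. (1999), §2.2 [GrimmettPercolation1999].
* R. Cerf, Ann. Probab. 43 (2015), arXiv:1306.3105, §10 [Cerf2015].
-/

noncomputable section

namespace Summit.CriticalPhenomena.PercolationContinuityZ3.Theorems

namespace ShellUniq

open Literature.Probability.Percolation Literature.Probability.LatticeModels
open Literature.Probability.Percolation.DCT16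
open MeasureTheory Filter Set

/-- **Shell segment, general radii.**  An open path of a lattice configuration inside `Λ_R` from
`u ∈ Λ_k` to a site `w ∉ Λ_q` (`k < q`) contains an open crossing of the shell `Λ_{q+1} ∖ Λ_k`:
there are `a ∈ ∂ⁱⁿΛ_{k+1}` and `b ∈ ∂ⁱⁿΛ_{q+1}` joined inside the shell, with `a` joined to `u`
inside `Λ_R` (first visit to the sphere `‖·‖ = q+1`, then back up to the last visit to the sphere
`‖·‖ = k+1`). [folklore] -/
theorem shell_segment_gen {k q R : ℕ} (hkq : k < q) {u w : Site 3} {ω : BondConfig (Site 3)}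
    (hω : ω ⊆ (zdGraph 3).edgeSet) (hu : u ∈ box 3 k) (hw : w ∉ box 3 q)
    (h : ω ∈ openConnIn (↑(box 3 R) : Set (Site 3)) u w) :
    ∃ a ∈ innerBoundary (zdGraph 3) (box 3 (k + 1)),
      ∃ b ∈ innerBoundary (zdGraph 3) (box 3 (q + 1)),
        ω ∈ openConnIn (↑(box 3 (q + 1) \ box 3 k) : Set (Site 3)) a b ∧
          ω ∈ openConnIn (↑(box 3 R) : Set (Site 3)) u a := by
  rw [mem_openConnIn_iff_pathIn] at h
  -- first exit from `Λ_q`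
  have hu1 : u ∈ (↑(box 3 q) : Set (Site 3)) := Finset.mem_coe.2 (box_mono 3 hkq.le hu)
  obtain ⟨a, b, ha, hb, -, hab, P1⟩ := h.exit (R := (↑(box 3 q) : Set (Site 3))) hu1
    (fun hw' => hw (Finset.mem_coe.1 hw'))
  have habG : (zdGraph 3).Adj a b := hω ((openGraph_adj _ _ _).1 hab).1
  have ha' : a ∈ box 3 q := Finset.mem_coe.1 ha
  have hb' : b ∉ box 3 q := fun h' => hb (Finset.mem_coe.2 h')
  have hb2 : b ∈ innerBoundary (zdGraph 3) (box 3 (q + 1)) := mem_innerBoundary_succ_of_adj ha' hb' habG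
  have hbbox : b ∈ box 3 (q + 1) := (mem_innerBoundary_iff.1 hb2).1
  -- `a` is outside `Λ_k` (its neighbour `b` is outside `Λ_q ⊇ Λ_{k+1}`)
  have hak : a ∉ box 3 k := fun hak => hb' (box_mono 3 (by omega) (mem_box_succ_of_adj hak habG))
  -- last visit of the reversed initial segment to the complement of `Λ_k`
  set T : Set (Site 3) := (↑(box 3 k) : Set (Site 3))ᶜ with hT
  have haT : a ∈ T := fun h' => hak (Finset.mem_coe.1 h')
  have huT : u ∉ T := fun h' => h' (Finset.mem_coe.2 hu)
  obtain ⟨a', b', ha'T, hb'T, -, ha'b', P2⟩ := P1.symm.exit (R := T) haT huT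
  have hb'k : b' ∈ box 3 k := by
    by_contra h'
    exact hb'T fun h'' => h' (Finset.mem_coe.1 h'')
  have ha'k : a' ∉ box 3 k := fun h' => ha'T (Finset.mem_coe.2 h')
  have ha'1 : a' ∈ innerBoundary (zdGraph 3) (box 3 (k + 1)) :=
    mem_innerBoundary_succ_of_adj hb'k ha'k
      (show (zdGraph 3).Adj b' a' from (hω ((openGraph_adj _ _ _).1 ha'b').1 : (zdGraph 3).Adj a' b').symm)
  -- the shell and the memberships
  set S : Set (Site 3) := (↑(box 3 (q + 1) \ box 3 k) : Set (Site 3)) with hS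
  have hmemS : ∀ z : Site 3, z ∈ box 3 (q + 1) → z ∉ box 3 k → z ∈ S := fun z hz hz' => by
    rw [hS, Finset.coe_sdiff]
    exact ⟨Finset.mem_coe.2 hz, fun h' => hz' (Finset.mem_coe.1 h')⟩
  have hbS : b ∈ S := hmemS b hbbox fun h' => hb' (box_mono 3 hkq.le h')
  have haS : a ∈ S := hmemS a (box_mono 3 (Nat.le_succ q) ha') hak
  have hsubS : T ∩ ((↑(box 3 q) : Set (Site 3)) ∩ ↑(box 3 R)) ⊆ S := by
    rintro z ⟨hzT, hz1, -⟩
    exact hmemS z (box_mono 3 (Nat.le_succ q) (Finset.mem_coe.1 hz1)) fun h' => hzT (Finset.mem_coe.2 h')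
  refine ⟨a', ha'1, b, hb2, ?_, ?_⟩
  · rw [mem_openConnIn_iff_pathIn]
    exact ((PathIn.of_adj hbS haS hab.symm).trans (P2.mono hsubS)).symm
  · rw [mem_openConnIn_iff_pathIn]
    exact (P1.mono Set.inter_subset_right).trans (P2.mono fun z hz => hz.2.2)

/-- **Two percolating sites not joined inside `Λ_R` split the shell `Λ_{q+1} ∖ Λ_k`** (`k < q`,
`q + 1 ≤ R`, `v ∈ Λ_k`, `ω ⊆ E(ℤ³)`): if `0 ↔ ∞` and `v ↔ ∞` but `0 ↮ v` inside `Λ_R`, there are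
two sites of `∂ⁱⁿΛ_{k+1}`, each joined inside the shell to `∂ⁱⁿΛ_{q+1}`, not joined to each other
inside the shell. [folklore] -/
theorem shell_split_gen {k q R : ℕ} (hkq : k < q) (hqR : q + 1 ≤ R) {v : Site 3} {ω : BondConfig (Site 3)}
    (hω : ω ⊆ (zdGraph 3).edgeSet) (hv : v ∈ box 3 k) (h0 : ω ∈ percolatesAt (0 : Site 3))
    (hvp : ω ∈ percolatesAt v) (hnc : ω ∉ openConnIn (↑(box 3 R) : Set (Site 3)) (0 : Site 3) v) :
    ∃ a ∈ innerBoundary (zdGraph 3) (box 3 (k + 1)), ∃ a' ∈ innerBoundary (zdGraph 3) (box 3 (k + 1)),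
      (∃ b ∈ innerBoundary (zdGraph 3) (box 3 (q + 1)),
          ω ∈ openConnIn (↑(box 3 (q + 1) \ box 3 k) : Set (Site 3)) a b) ∧
        (∃ b' ∈ innerBoundary (zdGraph 3) (box 3 (q + 1)),
          ω ∈ openConnIn (↑(box 3 (q + 1) \ box 3 k) : Set (Site 3)) a' b') ∧
          ω ∉ openConnIn (↑(box 3 (q + 1) \ box 3 k) : Set (Site 3)) a a' := by
  have hqR' : q < R := hqR
  obtain ⟨w, hw, h0w⟩ := toBdry_of_percolatesAt (zero_mem_box 3 R) hω h0
  obtain ⟨w', hw', hvw'⟩ := toBdry_of_percolatesAt (box_mono 3 (show k ≤ R by omega) hv) hω hvp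
  have hwb : w ∉ box 3 q := notMem_box_of_mem_innerBoundary_box hqR' hw
  have hw'b : w' ∉ box 3 q := notMem_box_of_mem_innerBoundary_box hqR' hw'
  obtain ⟨a, ha, b, hb, hab, h0a⟩ := shell_segment_gen hkq hω (zero_mem_box 3 k) hwb h0w
  obtain ⟨a', ha', b', hb', ha'b', hva'⟩ := shell_segment_gen hkq hω hv hw'b hvw'
  refine ⟨a, ha, a', ha', ⟨b, hb, hab⟩, ⟨b', hb', ha'b'⟩, fun haa' => hnc ?_⟩
  have hsub : (↑(box 3 (q + 1) \ box 3 k) : Set (Site 3)) ⊆ ↑(box 3 R) := by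
    rw [Finset.coe_sdiff]
    rintro z ⟨hz, -⟩
    exact Finset.coe_subset.2 (box_mono 3 hqR) hz
  have hva's : ω ∈ openConnIn (↑(box 3 R) : Set (Site 3)) a' v := by
    rw [mem_openConnIn_iff_pathIn] at hva' ⊢
    exact hva'.symm
  exact openConnIn_trans' (openConnIn_trans' h0a (openConnIn_mono' hsub haa')) hva's

/-- **The shell-uniqueness event of `Λ_{q+1} ∖ Λ_k` is determined by the pairs of sites of that
shell.** [folklore] -/
theorem determinedBy_shellUniq_gen (k q : ℕ) :
    DeterminedBy {ω : BondConfig (Site 3) |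
        ∀ a ∈ innerBoundary (zdGraph 3) (box 3 (k + 1)), ∀ a' ∈ innerBoundary (zdGraph 3) (box 3 (k + 1)),
          (∃ b ∈ innerBoundary (zdGraph 3) (box 3 (q + 1)),
              ω ∈ openConnIn (↑(box 3 (q + 1) \ box 3 k) : Set (Site 3)) a b) →
            (∃ b' ∈ innerBoundary (zdGraph 3) (box 3 (q + 1)),
              ω ∈ openConnIn (↑(box 3 (q + 1) \ box 3 k) : Set (Site 3)) a' b') →
              ω ∈ openConnIn (↑(box 3 (q + 1) \ box 3 k) : Set (Site 3)) a a'}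
      (↑((box 3 (q + 1) \ box 3 k).sym2) : Set (Sym2 (Site 3))) := by
  rw [determinedBy_iff]
  intro ω ω' hωω'
  have key : ∀ x y : Site 3, ω ∈ openConnIn (↑(box 3 (q + 1) \ box 3 k) : Set (Site 3)) x y ↔
      ω' ∈ openConnIn (↑(box 3 (q + 1) \ box 3 k) : Set (Site 3)) x y := fun x y =>
    (determinedBy_iff _ _).1 (determinedBy_openConnIn (↑(box 3 (q + 1) \ box 3 k) : Set (Site 3))
      x y (K := (↑((box 3 (q + 1) \ box 3 k).sym2) : Set (Sym2 (Site 3))))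
        (by rw [Finset.coe_sym2])) ω ω' hωω'
  simp only [Set.mem_setOf_eq, key]

end ShellUniq

open Literature.Probability.Percolation Literature.Probability.LatticeModels in
/-- **Registered sub-goal `shellSplitGen_of_percolating_pair` (crux stmt-CriticalPhenomena-0855,
line `registered`): two percolating sites not joined inside `Λ_R` split every shell
`Λ_{q+1} ∖ Λ_k ⊆ Λ_R` (`k < q < R`).**  Definitionally `ShellUniq.shell_split_gen`. [folklore] -/
theorem shellSplitGen_of_percolating_pair :
    ∀ (k q R : ℕ) (v : Site 3) (ω : BondConfig (Site 3)), k < q → q + 1 ≤ R → ω ⊆ (zdGraph 3).edgeSet →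
      v ∈ box 3 k → ω ∈ percolatesAt (0 : Site 3) → ω ∈ percolatesAt v →
        ω ∉ openConnIn (↑(box 3 R) : Set (Site 3)) (0 : Site 3) v →
          ∃ a ∈ innerBoundary (zdGraph 3) (box 3 (k + 1)), ∃ a' ∈ innerBoundary (zdGraph 3) (box 3 (k + 1)),
            (∃ b ∈ innerBoundary (zdGraph 3) (box 3 (q + 1)),
                ω ∈ openConnIn (↑(box 3 (q + 1) \ box 3 k) : Set (Site 3)) a b) ∧
              (∃ b' ∈ innerBoundary (zdGraph 3) (box 3 (q + 1)),
                ω ∈ openConnIn (↑(box 3 (q + 1) \ box 3 k) : Set (Site 3)) a' b') ∧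
                ω ∉ openConnIn (↑(box 3 (q + 1) \ box 3 k) : Set (Site 3)) a a' :=
  fun _ _ _ _ _ hkq hqR hω hv h0 hvp hnc => ShellUniq.shell_split_gen hkq hqR hω hv h0 hvp hnc

end Summit.CriticalPhenomena.PercolationContinuityZ3.Theorems

end
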